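import Literature.AnabelianGeometry.AbsoluteAnabelian.EllipticTorsionCovering
import HarnessLib

/-!
# [AbsTopII] Ex 3.2 (i), the `[N]`-covering subgroup `Π_U ⊆ Π_D`: elementary properties

S. Mochizuki, *Topics in Absolute Anabelian Geometry II* [AbsTopII] (bib `MochizukiAbsTopII2013`;
kurims manuscript `paper:url-585b8d0ad0d9`, render p0066), Example 3.2 (i) p. 66.

PROOF-ONLY companion (no definition, no instance, no structure) of `EllipticTorsionCovering.lean`
(abc-iut cell, row «COR34-DATUM» step (S1); seat abc-iut-L4-t4 gen 7): the three generators lie in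
`Π_U := CD.torsionCoveringSubgroup x N` (`K_x`, the `N`-th powers of `Δ`, `D_x` — hence `I_x`), `Π_U` is
closed, `K_x ≤ Δ` (the de-cuspidalization kernel is geometric), the `N`-th powers of `Δ` lie in `Δ`,
and for `N = 1` the subgroup is all of `Π` as soon as the cusp is rational (`Δ ⊔ D_x = Π`): the covering
`[1]_D` is the identity.  Sanity / vocabulary for the sequel rows (S2)–(S5) (pinned chains, canonical
outputs, Cor 3.4′).  HONEST FRAMING: elementary group theory about OUR definitions; typed ≠ proved for
anything in print; nothing here bears on [IUTchIII] Cor 3.12.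
-/

noncomputable section

open Topology
open scoped Pointwise

universe u

namespace Literature.AnabelianGeometry.AbsoluteAnabelian

namespace FundamentalExtension

variable (E : FundamentalExtension.{u})

/-- `δ ∈ Δ ⇒ δ^N ∈ ⟨Δ^N⟩`. [cite: MochizukiAbsTopII2013, Ex 3.2 (i) p.66] -/
theorem pow_mem_geomPowSubgroup (N : ℕ) {δ : E.arith} (hδ : δ ∈ E.geom) :
    δ ^ N ∈ E.geomPowSubgroup N :=
  Subgroup.subset_closure ⟨δ, hδ, rfl⟩

/-- `⟨Δ^N⟩ ≤ Δ`. [cite: MochizukiAbsTopII2013, Ex 3.2 (i) p.66] -/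
theorem geomPowSubgroup_le_geom (N : ℕ) : E.geomPowSubgroup N ≤ E.geom := by
  refine (Subgroup.closure_le _).2 ?_
  rintro _ ⟨δ, hδ, rfl⟩
  exact E.geom.pow_mem hδ N

/-- `⟨Δ^1⟩ = Δ`. [cite: MochizukiAbsTopII2013, Ex 3.2 (i) p.66] -/
theorem geomPowSubgroup_one : E.geomPowSubgroup 1 = E.geom := by
  refine le_antisymm (E.geomPowSubgroup_le_geom 1) fun δ hδ => ?_
  have h := E.pow_mem_geomPowSubgroup 1 hδ
  rwa [pow_one] at h

namespace CuspidalData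

variable {E} (CD : CuspidalData E)

/-- `I_x ≤ K_x`. [cite: MochizukiAbsTopII2013, Ex 3.2 (i) p.66] -/
theorem Icusp_le_cuspKernel (x : CD.Cusp) : CD.Icusp x ≤ CD.cuspKernel x :=
  (Subgroup.subset_normalClosure).trans (Subgroup.le_topologicalClosure _)

/-- `K_x` is closed. [cite: MochizukiAbsTopII2013, Ex 3.2 (i) p.66] -/
theorem isClosed_cuspKernel (x : CD.Cusp) : IsClosed (CD.cuspKernel x : Set E.arith) :=
  Subgroup.isClosed_topologicalClosure _

/-- `K_x` is normal in `Π`. [cite: MochizukiAbsTopII2013, Ex 3.2 (i) p.66] -/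
theorem cuspKernel_normal (x : CD.Cusp) : (CD.cuspKernel x).Normal :=
  Subgroup.is_normal_topologicalClosure _

/-- **`K_x ≤ Δ`**: the de-cuspidalization kernel is geometric (`I_x ≤ Δ`, `Δ` normal and closed).
[cite: MochizukiAbsTopII2013, Ex 3.2 (i) p.66] -/
theorem cuspKernel_le_geom (x : CD.Cusp) : CD.cuspKernel x ≤ E.geom := by
  unfold cuspKernel
  refine (Subgroup.topologicalClosure_minimal _ ?_ E.isClosed_geom)
  exact Subgroup.normalClosure_le_normal (CD.Icusp_le_geom x)

/-- `Π_U` is closed. [cite: MochizukiAbsTopII2013, Ex 3.2 (i) p.66] -/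
theorem isClosed_torsionCoveringSubgroup (x : CD.Cusp) (N : ℕ) :
    IsClosed (CD.torsionCoveringSubgroup x N : Set E.arith) :=
  Subgroup.isClosed_topologicalClosure _

/-- `K_x ≤ Π_U`: `Π_U` is a pull-back from the de-cuspidalized quotient `Π_E = Π_D / K_x`.
[cite: MochizukiAbsTopII2013, Ex 3.2 (i) p.66] -/
theorem cuspKernel_le_torsionCoveringSubgroup (x : CD.Cusp) (N : ℕ) :
    CD.cuspKernel x ≤ CD.torsionCoveringSubgroup x N :=
  (le_sup_left.trans le_sup_left).trans (Subgroup.le_topologicalClosure _)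

/-- `⟨Δ^N⟩ ≤ Π_U` (the image in `Π_E` is `N·Δ_E`). [cite: MochizukiAbsTopII2013, Ex 3.2 (i) p.66] -/
theorem geomPowSubgroup_le_torsionCoveringSubgroup (x : CD.Cusp) (N : ℕ) :
    E.geomPowSubgroup N ≤ CD.torsionCoveringSubgroup x N :=
  (le_sup_right.trans le_sup_left).trans (Subgroup.le_topologicalClosure _)

/-- `δ ∈ Δ ⇒ δ^N ∈ Π_U`. [cite: MochizukiAbsTopII2013, Ex 3.2 (i) p.66] -/
theorem pow_mem_torsionCoveringSubgroup (x : CD.Cusp) (N : ℕ) {δ : E.arith} (hδ : δ ∈ E.geom) :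
    δ ^ N ∈ CD.torsionCoveringSubgroup x N :=
  CD.geomPowSubgroup_le_torsionCoveringSubgroup x N (E.pow_mem_geomPowSubgroup N hδ)

/-- **`D_x ≤ Π_U`**: the covering `[N]_D` fixes the origin (the image of `D_x` in `Π_E` is the
decomposition group `D_O` of `O`, contained in `[N]_* Π_E`). [cite: MochizukiAbsTopII2013, Ex 3.2 (i) p.66] -/
theorem Dcusp_le_torsionCoveringSubgroup (x : CD.Cusp) (N : ℕ) :
    CD.Dcusp x ≤ CD.torsionCoveringSubgroup x N :=
  le_sup_right.trans (Subgroup.le_topologicalClosure _)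

/-- `I_x ≤ Π_U`. [cite: MochizukiAbsTopII2013, Ex 3.2 (i) p.66] -/
theorem Icusp_le_torsionCoveringSubgroup (x : CD.Cusp) (N : ℕ) :
    CD.Icusp x ≤ CD.torsionCoveringSubgroup x N :=
  (CD.Icusp_le_Dcusp x).trans (CD.Dcusp_le_torsionCoveringSubgroup x N)

/-- `Δ ⊔ D_x ≤ Π_U` for `N = 1`. [cite: MochizukiAbsTopII2013, Ex 3.2 (i) p.66] -/
theorem geom_sup_Dcusp_le_torsionCoveringSubgroup_one (x : CD.Cusp) :
    E.geom ⊔ CD.Dcusp x ≤ CD.torsionCoveringSubgroup x 1 := by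
  refine sup_le ?_ (CD.Dcusp_le_torsionCoveringSubgroup x 1)
  rw [← E.geomPowSubgroup_one]
  exact CD.geomPowSubgroup_le_torsionCoveringSubgroup x 1

/-- **For `N = 1` and a rational cusp (`Δ · D_x = Π`, i.e. `D_x ↠ G′`) the `[1]`-covering subgroup is
all of `Π_D`**: `[1]_D` is the identity. [cite: MochizukiAbsTopII2013, Ex 3.2 (i) p.66] -/
theorem torsionCoveringSubgroup_one_eq_top (x : CD.Cusp) (hx : E.geom ⊔ CD.Dcusp x = ⊤) :
    CD.torsionCoveringSubgroup x 1 = ⊤ :=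
  top_le_iff.1 (hx.ge.trans (CD.geom_sup_Dcusp_le_torsionCoveringSubgroup_one x))

/-- The cusp is RATIONAL (`D_x ↠ G′`, i.e. `aug(D_x) = G′`) iff `Δ ⊔ D_x = Π`.
[cite: MochizukiAbsTopII2013, Ex 3.2 (i) p.66] -/
theorem geom_sup_Dcusp_eq_top_iff (x : CD.Cusp) :
    E.geom ⊔ CD.Dcusp x = ⊤ ↔ (CD.Dcusp x).map E.aug.toMonoidHom = ⊤ := by
  constructor
  · intro h
    rw [eq_top_iff]
    intro g _
    obtain ⟨y, rfl⟩ := E.aug_surjective g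
    have hy : y ∈ E.geom ⊔ CD.Dcusp x := h ▸ Subgroup.mem_top y
    have hy' : y ∈ (E.geom : Set E.arith) * (CD.Dcusp x : Set E.arith) := by
      rw [← Subgroup.normal_mul]; exact hy
    obtain ⟨δ, hδ, d, hd, rfl⟩ := Set.mem_mul.1 hy'
    refine ⟨d, hd, ?_⟩
    have hδ1 : E.aug δ = 1 := E.mem_geom.1 hδ
    simp [hδ1]
  · intro h
    rw [eq_top_iff]
    intro y _
    have hy : E.aug y ∈ (CD.Dcusp x).map E.aug.toMonoidHom := h ▸ Subgroup.mem_top _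
    obtain ⟨d, hd, hdy⟩ := hy
    have hmem : y * d⁻¹ ∈ E.geom := by
      rw [E.mem_geom, map_mul, map_inv, ← show E.aug d = E.aug y from hdy, mul_inv_cancel]
    have : y = (y * d⁻¹) * d := by group
    rw [this]
    exact Subgroup.mul_mem _ (Subgroup.mem_sup_left hmem) (Subgroup.mem_sup_right hd)

end CuspidalData

end FundamentalExtension

end Literature.AnabelianGeometry.AbsoluteAnabelian

end
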